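import Summits.BirchSwinnertonDyer.BirchSwinnertonDyer.Theorems.SchneiderFreeAdditiveX3PoitouTateShaDualityHolds
import Summits.BirchSwinnertonDyer.BirchSwinnertonDyer.Theorems.ThetaPartnerAtTwoSignedControlAtTwoGlobalHTwoFiniteSupport
import Literature.NumberTheory.EllipticCurves.KummerSelmerStructure
import Literature.NumberTheory.GaloisRepresentations.HomDualReadoutUnramified
import Literature.NumberTheory.GaloisRepresentations.GaloisCohomologyKummerProofs
import Summits.BirchSwinnertonDyer.Rank1Residual.X11b.AnticyclotomicLevelStructure
import HarnessLib

/-!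
# Poitou–Tate duality of `Ш¹(K, μ_m)` and `Ш²(K, ℤ/m)` — the named fact `poitouTate_sha_zmod_mu K` — HOLDS for EVERY
# number field

Cell `bsd-schneider-ideate`, seat `bsd-schneider-door-c4` (prover, generation 20).  PARTITION: board row B6 ∩ X3 ∩ sst-twist,
`r = 1`, of `Rank1Residual.partition` — CONTROL corner (crux `AnticycControlAdditiveK`, item stmt-BirchSwinnertonDyer-19295,
CLOSED·proved 2026-08-28 by `anticycControlAdditiveK_proof`; facts binder `ControlFacts` 19538 CLOSED).  bears_on: K1-door
(r1, B6∩X3-sst) (route-BirchSwinnertonDyer-SchneiderFreeAdditiveX3 items 18969 → 19295).  This file is the follow-through of the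
corner's road: the cell proved Poitou–Tate duality (b) `poitouTate_sha_tateDual K` for every number field and every finite
Galois module (`poitouTate_sha_tateDual_holds`, door-c4 g19, on the Route-A Tate duality for the idèle class formation of
door-c4/c5/c6 g10–g19 and bsd-wall's `Ш²`-readout road); here its SPECIAL CASE `M = ℤ/m`, `M' = μ_m` — vendored separately and
earlier as the named fact `Literature.NumberTheory.GaloisCohomology.poitouTate_sha_zmod_mu K` (`PoitouTateSha.lean`; consumed by
`ShaOneMuPrime.lean`, `ShaOneMuTwoPow.lean`, `ProjectiveLiftingOfPoitouTate.lean`, `TateProjectiveLiftingOfPoitouTate.lean`,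
`TateSpinLiftContinuousH2Proofs.lean`, and the Langlands summit) — is DISCHARGED.

## The result and its proof

* `poitouTate_sha_zmod_mu_holds (K) : poitouTate_sha_zmod_mu K` — for every number field `K` and every `m ≥ 1`:
  (i) every class of `H²(K, ℤ/m)` is locally zero outside a finite set of places; (ii) `Ш¹(K, μ_m)` and `Ш²(K, ℤ/m)` are finite
  and there is a bi-additive pairing `Ш²(K, ℤ/m) × Ш¹(K, μ_m) → ℤ/m` both of whose adjoints are bijective (Harari Thm. 17.13 (b),
  Lemma 17.8, Prop. 17.6; Milne *ADT* I Thm. 4.10 (a), Lemma 4.8; Tate 1962 Thm. 3.1).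
  Clause (i) is bsd-wall's theorem `SignedEC.H2FiniteSupport.finite_setOf_localization_two_trivial_zmod_ne_zero` (finite support of
  `β²` for every finite module) BY NAME.  Clause (ii) is `poitouTate_sha_tateDual_holds K` at `ρ = ℤ/m` (trivial action), `n = m`,
  TRANSPORTED along the `Γ_K`-equivariant isomorphism `(ℤ/m)^D = Hom(ℤ/m, μ_m) ≅ μ_m`, `f ↦ f 1` (inverse `ζ ↦ (k ↦ k • ζ)`):
  `evalOne` / `ofMu` (continuous intertwining maps), `shaCongr` (an equivariant map carries `Ш¹` to `Ш¹` —
  `X11b.Levels.localization_map_one` = `galoisCohomology.res_map_one` at every completion — and a pair of mutually inverse ones gives `Ш¹(K, M) ≃+ Ш¹(K, N)`),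
  `shaTateDualTrivEquiv : Ш¹(K, (ℤ/m)^D) ≃+ Ш¹(K, μ_m)`, and `pairingCongrRight` (re-indexing the second argument of a perfect
  pairing along an additive isomorphism keeps both adjoints bijective).
* CONSEQUENCES are drawn in the sibling file `SchneiderFreeAdditiveX3PoitouTateShaZModMuConsequences.lean`: `Ш²(K, ℤ/pⁿ) = 0`
  (every `K`, odd `p`; `K ⊇ μ_{pⁿ}`; `K ∋ √-1` at `p = 2`), Tate's theorem `H²(Γ_K, ℚ/ℤ) = 0` in cochain form (odd part for
  every number field; all of it for `K ∋ √-1`), and the Patrikis 2019 lifting facts reduced to `(H_2)(Γ_K)` on the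
  Grunwald–Wang locus alone.

HONEST FRAMING.  An in-tree proof of a PUBLISHED theorem (Poitou–Tate 1962/66, the case `M = ℤ/m`) that the tree carried as a
cite-only named fact, plus by-name discharges downstream; definitions with bodies and theorems only (no new named fact, no
instance, no `sorry`).  It is NOT a case of BSD, closes no route item and moves no mark («closes rung: none»); the `2`-primary
part of Tate's theorem for number fields WITHOUT `√-1` (the Grunwald–Wang locus) is NOT proved here.

## References
* D. Harari, *Galois Cohomology and Class Field Theory* (2020), Prop. 17.6, Lemma 17.8, Thm. 17.13 (b), Cor. 18.12, Thm. 18.15,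
  Cor. 18.17, Rem. 18.11. [Harari2020]
* J. S. Milne, *Arithmetic Duality Theorems* (2nd ed. 2006), Ch. I, Lemma 4.8, Thm. 4.10 (a). [MilneADT2006]
* J. Tate, *Duality theorems in Galois cohomology over number fields*, Proc. ICM 1962, Thm. 3.1. [Tate1963DualityICM]
* J.-P. Serre, *Modular forms of weight one and Galois representations* (Durham 1977), §6.1 Thm. 4, §6.5. [SerreDurham1977]
* S. Patrikis, *Variations on a theorem of Tate*, Mem. AMS 258 (2019), §2.1. [Patrikis2019]
-/

noncomputable section

-- `Summit.<P>.<Sub>` repeats `BirchSwinnertonDyer` by the tree's layout convention (D-0017)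
set_option linter.dupNamespace false

namespace Summit.BirchSwinnertonDyer.BirchSwinnertonDyer.Theorems.SchneiderFreeAdditiveX3.PoitouTateReduction

open Literature.NumberTheory.GaloisRepresentations Literature.NumberTheory.GaloisCohomology
open Literature.NumberTheory.GaloisRepresentations.DiscreteGaloisModule
open Field Function NumberField
open scoped ContRepresentation

section Transport

variable (K : Type) [Field K] (m : ℕ)

/-- The trivial discrete `Γ_K`-module `ℤ/m`. [folklore] -/
abbrev trivZMod : DiscreteGaloisModule K (ZMod m) :=
  ContinuousRep.trivial (absoluteGaloisGroup K) ℤ (ZMod m)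

/-- `μ_m` is killed by `m`. [folklore] -/
theorem nsmul_muCarrier_eq_zero (ζ : MuCarrier K m) : m • ζ = 0 := by
  apply muVal_injective K m
  rw [muVal_nsmul, muVal_pow_eq_one, muVal_zero]

/-- Evaluation at `1 : ℤ/m`, `Hom(ℤ/m, μ_m) → μ_m`, as an additive map. [folklore] -/
def evalOneHom : TateDual K (ZMod m) m →+ MuCarrier K m where
  toFun f := MuCarrier.toAdditive.symm (f 1)
  map_zero' := by simp
  map_add' f g := by simp

/-- Unfolding `evalOneHom`. [folklore] -/
@[simp] theorem evalOneHom_apply (f : TateDual K (ZMod m) m) :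
    evalOneHom K m f = MuCarrier.toAdditive.symm (f 1) := rfl

/-- The additive map `ℤ/m → μ_m`, `k ↦ k • ζ`, attached to `ζ ∈ μ_m` (through `ZMod.lift`). [folklore] -/
def ofMuFun (ζ : MuCarrier K m) : ZMod m →+ Additive (rootsOfUnity m (AlgebraicClosure K)) :=
  ZMod.lift m ⟨zmultiplesHom _ (MuCarrier.toAdditive ζ), by
    change ((m : ℕ) : ℤ) • MuCarrier.toAdditive ζ = 0
    rw [natCast_zsmul, ← map_nsmul, nsmul_muCarrier_eq_zero, map_zero]⟩

/-- `ofMuFun ζ` on the class of an integer `z` is `z • ζ`. [folklore] -/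
theorem ofMuFun_intCast (ζ : MuCarrier K m) (z : ℤ) :
    ofMuFun K m ζ (z : ZMod m) = z • MuCarrier.toAdditive ζ := by
  rw [ofMuFun, ZMod.lift_coe]
  simp

/-- The inverse: `ζ ↦ (k ↦ k • ζ)`, `μ_m → Hom(ℤ/m, μ_m)`. [folklore] -/
def ofMuHom : MuCarrier K m →+ TateDual K (ZMod m) m where
  toFun ζ := (ofMuFun K m ζ : ZMod m →+ Additive (rootsOfUnity m (AlgebraicClosure K)))
  map_zero' := by
    refine TateDual.ext fun k => ?_
    obtain ⟨z, rfl⟩ := ZMod.intCast_surjective k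
    change ofMuFun K m 0 (z : ZMod m) = 0
    rw [ofMuFun_intCast, map_zero, zsmul_zero]
  map_add' ζ ζ' := by
    refine TateDual.ext fun k => ?_
    obtain ⟨z, rfl⟩ := ZMod.intCast_surjective k
    change ofMuFun K m (ζ + ζ') (z : ZMod m) = ofMuFun K m ζ (z : ZMod m) + ofMuFun K m ζ' (z : ZMod m)
    rw [ofMuFun_intCast, ofMuFun_intCast, ofMuFun_intCast, map_add, zsmul_add]

/-- `ofMuHom ζ` on the class of an integer `z` is `z • ζ`. [folklore] -/
theorem ofMuHom_apply_intCast (ζ : MuCarrier K m) (z : ℤ) :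
    ofMuHom K m ζ (z : ZMod m) = z • MuCarrier.toAdditive ζ := by
  change ofMuFun K m ζ (z : ZMod m) = _
  rw [ofMuFun_intCast]

/-- `(k ↦ k • ζ) 1 = ζ`. [folklore] -/
theorem evalOneHom_ofMuHom (ζ : MuCarrier K m) : evalOneHom K m (ofMuHom K m ζ) = ζ := by
  rw [evalOneHom_apply]
  have h := ofMuHom_apply_intCast K m ζ 1
  rw [Int.cast_one, one_zsmul] at h
  rw [h]
  rfl

/-- `k ↦ k • f 1` is `f`, for an additive `f : ℤ/m → μ_m`. [folklore] -/
theorem ofMuHom_evalOneHom (f : TateDual K (ZMod m) m) : ofMuHom K m (evalOneHom K m f) = f := by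
  refine TateDual.ext fun k => ?_
  obtain ⟨z, rfl⟩ := ZMod.intCast_surjective k
  rw [ofMuHom_apply_intCast, evalOneHom_apply]
  change z • f 1 = f (z : ZMod m)
  rw [← map_zsmul (f : ZMod m →+ Additive (rootsOfUnity m (AlgebraicClosure K))) z 1, zsmul_one]

/-- Evaluation at `1` is a bijection `Hom(ℤ/m, μ_m) ≃ μ_m`. [folklore] -/
theorem evalOneHom_bijective : Bijective (evalOneHom K m) :=
  Function.bijective_iff_has_inverse.2
    ⟨ofMuHom K m, ofMuHom_evalOneHom K m, evalOneHom_ofMuHom K m⟩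

/-- `ζ ↦ (k ↦ k • ζ)` is a bijection `μ_m ≃ Hom(ℤ/m, μ_m)`. [folklore] -/
theorem ofMuHom_bijective : Bijective (ofMuHom K m) :=
  Function.bijective_iff_has_inverse.2
    ⟨evalOneHom K m, evalOneHom_ofMuHom K m, ofMuHom_evalOneHom K m⟩

variable [NeZero m]

/-- **`(ℤ/m)^D = Hom(ℤ/m, μ_m) → μ_m`, `f ↦ f 1`, is `Γ_K`-equivariant** (for the Tate-dual action
`(σ f)(k) = σ (f (σ⁻¹ k)) = σ (f k)` of the trivial module). [folklore] -/
def evalOne : ((trivZMod K m).tateDual m).toContRepresentation →ⁱL (mu K m).toContRepresentation where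
  toContinuousLinearMap := ⟨(evalOneHom K m).toIntLinearMap, continuous_of_discreteTopology⟩
  isIntertwining' σ := by
    refine ContinuousLinearMap.ext fun f => ?_
    apply MuCarrier.toAdditive.injective
    simp only [ContinuousLinearMap.coe_comp, ContinuousLinearMap.coe_mk', Function.comp_apply,
      ContinuousRep.toContRepresentation_apply_apply, AddMonoidHom.coe_toIntLinearMap, evalOneHom_apply,
      tateDual_apply_apply_apply, ContinuousRep.trivial_apply, AddEquiv.apply_symm_apply]
    rfl

/-- Unfolding `evalOne`. [folklore] -/
@[simp] theorem evalOne_apply (f : TateDual K (ZMod m) m) : evalOne K m f = evalOneHom K m f := rfl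

/-- The inverse equivariant map `μ_m → (ℤ/m)^D`, `ζ ↦ (k ↦ k • ζ)`. [folklore] -/
def ofMu : (mu K m).toContRepresentation →ⁱL ((trivZMod K m).tateDual m).toContRepresentation where
  toContinuousLinearMap := ⟨(ofMuHom K m).toIntLinearMap, continuous_of_discreteTopology⟩
  isIntertwining' σ := by
    refine ContinuousLinearMap.ext fun ζ => ?_
    change ofMuHom K m (mu K m σ ζ) = (trivZMod K m).tateDual m σ (ofMuHom K m ζ)
    refine TateDual.ext fun k => ?_
    obtain ⟨z, rfl⟩ := ZMod.intCast_surjective k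
    rw [tateDual_apply_apply_apply, ofMuHom_apply_intCast]
    change _ = mu K m σ (ofMuHom K m ζ ((trivZMod K m) σ⁻¹ (z : ZMod m)))
    rw [ContinuousRep.trivial_apply, ofMuHom_apply_intCast]
    change z • MuCarrier.toAdditive (mu K m σ ζ) = MuCarrier.toAdditive (mu K m σ (MuCarrier.toAdditive.symm (z • MuCarrier.toAdditive ζ)))
    rw [← map_zsmul, ← map_zsmul]
    rfl

/-- Unfolding `ofMu`. [folklore] -/
@[simp] theorem ofMu_apply (ζ : MuCarrier K m) : ofMu K m ζ = ofMuHom K m ζ := rfl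

end Transport

/-! ## `H¹` transport: an equivariant map of discrete Galois modules carries `Ш¹` to `Ш¹` -/

section ShaMap

variable {K : Type} [Field K] [NumberField K]
variable {M N : Type} [AddCommGroup M] [TopologicalSpace M] [DiscreteTopology M]
  [AddCommGroup N] [TopologicalSpace N] [DiscreteTopology N]
  {ρ : DiscreteGaloisModule K M} {ρ' : DiscreteGaloisModule K N}

/-- **`H¹(f)` maps `Ш¹(K, M)` into `Ш¹(K, N)`** for every continuous equivariant `f : M → N`. [cite: MilneADT2006, Ch. I §4] -/
theorem map_one_mem_sha (f : ρ.toContRepresentation →ⁱL ρ'.toContRepresentation) {c : galoisCohomology ρ 1}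
    (hc : c ∈ sha ρ) : galoisCohomology.map f 1 c ∈ sha ρ' := by
  rw [mem_sha_iff] at hc ⊢
  intro v
  rw [Summit.BirchSwinnertonDyer.Rank1Residual.X11b.Levels.localization_map_one, hc v]
  exact map_zero _

omit [NumberField K] in
/-- **`H¹(g) ∘ H¹(f) = id` when `g ∘ f = id`** (on classes of continuous crossed homomorphisms).
[cite: SerreGaloisCohomology1997, I §2.2] -/
theorem map_one_map_one_eq_self (f : ρ.toContRepresentation →ⁱL ρ'.toContRepresentation)
    (g : ρ'.toContRepresentation →ⁱL ρ.toContRepresentation) (hgf : ∀ x : M, g (f x) = x)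
    (c : galoisCohomology ρ 1) : galoisCohomology.map g 1 (galoisCohomology.map f 1 c) = c := by
  obtain ⟨φ, rfl⟩ := oneCocycleClass_surjective _ c
  rw [galoisCohomology.map_one_oneCocycleClass, galoisCohomology.map_one_oneCocycleClass]
  exact congrArg (oneCocycleClass _) (Subtype.ext (ContinuousMap.ext fun σ => hgf (φ.1 σ)))

/-- **`Ш¹` along a pair of mutually inverse equivariant maps**: `H¹(f)` restricts to an additive isomorphism
`Ш¹(K, M) ≃+ Ш¹(K, N)` with inverse `H¹(g)`. [cite: MilneADT2006, Ch. I §4] -/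
def shaCongr (f : ρ.toContRepresentation →ⁱL ρ'.toContRepresentation)
    (g : ρ'.toContRepresentation →ⁱL ρ.toContRepresentation) (hgf : ∀ x : M, g (f x) = x)
    (hfg : ∀ y : N, f (g y) = y) : sha ρ ≃+ sha ρ' where
  toFun c := ⟨galoisCohomology.map f 1 c, map_one_mem_sha f c.2⟩
  invFun d := ⟨galoisCohomology.map g 1 d, map_one_mem_sha g d.2⟩
  left_inv c := Subtype.ext (map_one_map_one_eq_self f g hgf c)
  right_inv d := Subtype.ext (map_one_map_one_eq_self g f hfg d)
  map_add' _ _ := Subtype.ext (map_add _ _ _)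

/-- Unfolding `shaCongr` on underlying classes. [folklore] -/
@[simp] theorem coe_shaCongr_apply (f : ρ.toContRepresentation →ⁱL ρ'.toContRepresentation)
    (g : ρ'.toContRepresentation →ⁱL ρ.toContRepresentation) (hgf : ∀ x : M, g (f x) = x)
    (hfg : ∀ y : N, f (g y) = y) (c : sha ρ) :
    (shaCongr f g hgf hfg c : galoisCohomology ρ' 1) = galoisCohomology.map f 1 c := rfl

end ShaMap

/-! ## Transport of a perfect pairing along an additive isomorphism of the second argument -/

section Pairing

variable {A B B' C : Type*} [AddCommGroup A] [AddCommGroup B] [AddCommGroup B'] [AddCommGroup C]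

/-- Re-index the second argument of a bi-additive pairing along `e : B ≃+ B'`: `b' a y = b a (e⁻¹ y)`. [folklore] -/
def pairingCongrRight (b : A →+ B →+ C) (e : B ≃+ B') : A →+ B' →+ C :=
  (e.addMonoidHomCongrLeft (N := C)).toAddMonoidHom.comp b

/-- Unfolding `pairingCongrRight`. [folklore] -/
@[simp] theorem pairingCongrRight_apply_apply (b : A →+ B →+ C) (e : B ≃+ B') (a : A) (y : B') :
    pairingCongrRight b e a y = b a (e.symm y) := rfl

/-- The left adjoint of the re-indexed pairing is bijective if the original one is. [folklore] -/
theorem pairingCongrRight_bijective {b : A →+ B →+ C} (hb : Bijective b) (e : B ≃+ B') :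
    Bijective (pairingCongrRight b e) :=
  (e.addMonoidHomCongrLeft (N := C)).bijective.comp hb

/-- The right adjoint of the re-indexed pairing is the original right adjoint precomposed with `e⁻¹`. [folklore] -/
theorem flip_pairingCongrRight (b : A →+ B →+ C) (e : B ≃+ B') :
    (pairingCongrRight b e).flip = b.flip.comp e.symm.toAddMonoidHom :=
  AddMonoidHom.ext fun _ => AddMonoidHom.ext fun _ => rfl

/-- The right adjoint of the re-indexed pairing is bijective if the original one is. [folklore] -/
theorem pairingCongrRight_flip_bijective {b : A →+ B →+ C} (hb : Bijective b.flip) (e : B ≃+ B') :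
    Bijective (pairingCongrRight b e).flip := by
  rw [flip_pairingCongrRight]
  exact hb.comp e.symm.bijective

end Pairing

/-! ## The named fact -/

section Holds

open Summit.BirchSwinnertonDyer.BirchSwinnertonDyer.Theorems.SignedEC.H2FiniteSupport
  (finite_setOf_localization_two_trivial_zmod_ne_zero)

/-- `Ш¹(K, (ℤ/m)^D) ≃+ Ш¹(K, μ_m)` along `f ↦ f 1`. [cite: MilneADT2006, Ch. I §4] -/
def shaTateDualTrivEquiv (K : Type) [Field K] [NumberField K] (m : ℕ) [NeZero m] :
    sha ((trivZMod K m).tateDual m) ≃+ sha (mu K m) :=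
  shaCongr (evalOne K m) (ofMu K m) (ofMuHom_evalOneHom K m) (evalOneHom_ofMuHom K m)

/-- `ℤ/m` is killed by `m`. [folklore] -/
theorem nsmul_zmod_eq_zero (m : ℕ) (k : ZMod m) : m • k = 0 := by
  rw [nsmul_eq_mul, ZMod.natCast_self, zero_mul]

/-- **Poitou–Tate duality of `Ш¹(K, μ_m)` and `Ш²(K, ℤ/m)`, with the finiteness of the support of global
`H²(K, ℤ/m)`-classes — the named fact `poitouTate_sha_zmod_mu K` — for EVERY number field `K`.**
Clause (i) (Harari Lemma 17.8 with Prop. 17.6 in degree `2`) is bsd-wall's theorem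
`finite_setOf_localization_two_trivial_zmod_ne_zero` (every finite module); clauses (ii)–(iv) (Harari Thm. 17.13 (b) for
`M = ℤ/m`, `M' = μ_m`) are the case `ρ = ℤ/m` (trivial action), `n = m` of the general duality
`poitouTate_sha_tateDual_holds K` (Milne I Thm. 4.10 (a)), transported along the `Γ_K`-isomorphism
`(ℤ/m)^D = Hom(ℤ/m, μ_m) ≅ μ_m`, `f ↦ f 1` (`shaTateDualTrivEquiv`). A published theorem re-proved in the tree; not a case of BSD.
[cite: Harari2020, Thm. 17.13 (b), Lemma 17.8, Prop. 17.6][cite: MilneADT2006, Ch. I, Thm. 4.10 (a), Lemma 4.8][cite: Tate1963DualityICM, Thm. 3.1] -/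
theorem poitouTate_sha_zmod_mu_holds (K : Type) [Field K] [NumberField K] : poitouTate_sha_zmod_mu K := by
  intro m _
  obtain ⟨hfin, hfin₂, b, hb, hbf⟩ :=
    poitouTate_sha_tateDual_holds K m (ZMod m) (trivZMod K m) (nsmul_zmod_eq_zero m)
  refine ⟨finite_setOf_localization_two_trivial_zmod_ne_zero m, ?_, hfin₂,
    pairingCongrRight b (shaTateDualTrivEquiv K m), pairingCongrRight_bijective hb _,
    pairingCongrRight_flip_bijective hbf _⟩
  exact Finite.of_equiv _ (shaTateDualTrivEquiv K m).toEquiv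

end Holds

end Summit.BirchSwinnertonDyer.BirchSwinnertonDyer.Theorems.SchneiderFreeAdditiveX3.PoitouTateReduction

end
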